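import Mathlib
import HarnessLib
import Literature.MathematicalPhysics.QuantumLattice.GrassmannSourceGrading
import Summits.HubbardSuperconductivity.HubbardSuperconductivity.Theorems.KLProgrammeKLRegimeTwoVolumeSourceProfileDefs

/-!
# Route `KLProgramme` — crux K3, VL child `KLRegimeVolumeLimitV17F2` (stmt-HubbardSuperconductivity-20440), (vi) blueprint v4, BETWEEN THE SCALES OF
# THE SPINE: the KEYED block-reduced two-volume defect through the SOURCE TRUNCATION `srcTrunc 3`, and its «everywhere» bound from one-volume profiles
# (cell gate-hubbard-kl, seat hubbard-kl-k3c5-p3 g13, technique «OS-positivity-free direct assembly»; `--supports` stmt-…-20440)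

The per-scale two-volume theorems of the (vi) chain (`…TwoVolumeSectorScaleSucc` M3a, `…TwoVolumeGridSectorScaleSucc` M3-grid,
`…TwoVolumeSrcSectorScaleSucc` M3d, p584890) conclude, at a deep fine pin `w`, in every degree, in the e-KEYED block-reduced currency of a block
structure `ed : Γ′ ≃ ι × Γ` (fine labels `Γ′`, blocks `ι`, coarse labels `Γ`):
`Σ_{X : X p = w} ‖kernel O′ X − (if ∀ i, (ed (X i)).1 = (ed (X p)).1 then kernel O (fun i => (ed (X i)).2) else 0)‖ ≤ …`
for the UNTRUNCATED outputs `O′ = effAction C⁺_{L″} (map T⁺_{L″} 𝒲′)`, `O = effAction C⁺_L (map T⁺_L 𝒲)`, whereas the objects the NEXT scale (and, at the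
top scale, the END door `…VolumeLimitV9GluedDefectDoor.stub_vl_nestedFramed_of_gluedDefect_keyed`) reads are the SOURCE-TRUNCATED ones
`W⁺ := srcTrunc (·.2 = 1) 3 (…)` (blueprint v4 §2: token #24 supplies the source profiles with `≤ 2` source legs only; the truncation is exact along
the flow by `GrassmannSourceGrading.srcTrunc_map_effAction_srcTrunc`).  This file supplies the two generic bricks the spine uses between consecutive
scales, in exactly that currency:

* §1 `sum_filter_ite_blockTest_eq` / `sum_filter_norm_keyedReduced_eq` — the in-block strings pinned at `w` ARE the coarse strings pinned at `(ed w).2`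
  (reindexing by `ed`), hence **`sum_filter_norm_keyedGlued_le_add`**: the «everywhere» two-volume defect (the next scale's input `hNDj`) is at most the
  fine one-volume pinned profile plus the coarse one-volume pinned profile — no two-volume content;
* §2 **`sum_norm_kernel_srcTrunc_keyedGlued_mul_le`** — for source predicates `P′` (fine) / `P` (coarse) compatible with the residue map
  (`P (ed x).2 ↔ P′ x`), the keyed block-reduced defect of the truncations `srcTrunc P′ k A′` vs `srcTrunc P k A` is termwise, hence over every finite set
  of strings and with every non-negative weight, at most that of `A′` vs `A` (both sides are truncated by the SAME test, `srcCount_keyedResidue_eq`);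
* §3 the decorated-leg / `SrcLabel` instances the chain uses: for the doubled block structure `ed` over a sector-field block structure `e`
  (`…TwoVolumeDoubledData.exists_doubledEquiv`: `ed (x, s) = ((e x).1, ((e x).2, s))`) the residue keeps the copy index, so the copy predicate `(·.2 = c)` is
  compatible (`copyPred_iff_of_doubledEquiv`) and **`srcLabel_sum_filter_norm_srcTrunc_keyedGlued_le`** is M3d's conclusion summand with `srcTrunc ℂ (·.2 = 1) k`
  inserted on both sides, dominated by M3d's own left-hand side; the e-free twin (`…_gluedFree_le`, M4a's / the `_forall` door's test
  `∀ i j, ⌊site_j (X i)/L⌋ = ⌊site_j (X p)/L⌋` and explicit residue string) is included.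

Proofs only (finite sums, `kernel_srcTrunc`); no definition; nothing about the model's sizes is asserted.
References: BGM 2006 §2.9 (4.3)–(4.6) (the order-`≤ 2` truncation in the external field); Salmhofer 1999 §4.3 (4.95), (2.102)–(2.106).
-/

noncomputable section

namespace Summit.HubbardSuperconductivity.HubbardSuperconductivity.Theorems.TwoVolumeDefect

set_option linter.dupNamespace false -- summit = problem name (single-conjunct summit), D-0017

open Finset Literature.MathematicalPhysics.QuantumLattice GrassmannAlgebra Literature.Probability.LatticeModels

/-! ## §1 The keyed block-reduced strings: reindexing by `ed`, and the «everywhere» defect from one-volume profiles -/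

section Keyed

variable {𝕜 : Type*} [RCLike 𝕜] {Γ Γ' ι : Type*} [Fintype Γ] [DecidableEq Γ] [Fintype Γ'] [DecidableEq Γ'] [DecidableEq ι]
  (ed : Γ' ≃ ι × Γ)

/-- **Reindexing by the block structure**: summing `F` of the residue string over the fine strings pinned at `w` whose legs all lie in the block of
leg `p` is summing `F` over the coarse strings pinned at the residue `(ed w).2` (the map `X ↦ (ed ∘ X).2` is a bijection there, with inverse
`Y ↦ ed⁻¹ ((ed w).1, Y ·)`). [folklore] -/
theorem sum_filter_ite_blockTest_eq {m : ℕ} (F : (Fin m → Γ) → ℝ) (p : Fin m) (w : Γ') :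
    ∑ X ∈ univ.filter (fun X : Fin m → Γ' => X p = w),
        (if ∀ i, (ed (X i)).1 = (ed (X p)).1 then F (fun i => (ed (X i)).2) else 0) =
      ∑ Y ∈ univ.filter (fun Y : Fin m → Γ => Y p = (ed w).2), F Y := by
  rw [← sum_filter]
  refine sum_nbij' (fun X => fun i => (ed (X i)).2) (fun Y => fun i => ed.symm ((ed w).1, Y i)) ?_ ?_ ?_ ?_ ?_
  · intro X hX
    simp only [mem_filter, mem_univ, true_and] at hX ⊢
    rw [hX.1]
  · intro Y hY
    simp only [mem_filter, mem_univ, true_and] at hY ⊢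
    refine ⟨?_, fun i => ?_⟩
    · rw [hY, Prod.mk.eta, Equiv.symm_apply_apply]
    · rw [Equiv.apply_symm_apply, Equiv.apply_symm_apply]
  · intro X hX
    simp only [mem_filter, mem_univ, true_and] at hX
    funext i
    rw [← hX.1, ← hX.2 i, Prod.mk.eta, Equiv.symm_apply_apply]
  · intro Y hY
    funext i
    simp only [Equiv.apply_symm_apply]
  · intro X hX
    rfl

/-- **The keyed reduced kernels pinned at `w` have the coarse pinned profile at the residue `(ed w).2`.** [folklore] -/
theorem sum_filter_norm_keyedReduced_eq (A : GrassmannAlgebra 𝕜 Γ) {m : ℕ} (p : Fin m) (w : Γ') :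
    ∑ X ∈ univ.filter (fun X : Fin m → Γ' => X p = w),
        ‖(if ∀ i, (ed (X i)).1 = (ed (X p)).1 then kernel 𝕜 A m (fun i => (ed (X i)).2) else 0)‖ =
      ∑ Y ∈ univ.filter (fun Y : Fin m → Γ => Y p = (ed w).2), ‖kernel 𝕜 A m Y‖ := by
  rw [← sum_filter_ite_blockTest_eq ed (fun Y => ‖kernel 𝕜 A m Y‖) p w]
  refine sum_congr rfl fun X _ => ?_
  split_ifs
  · rfl
  · exact norm_zero

/-- **The «everywhere» keyed two-volume defect is at most the two ONE-volume pinned profiles** (fine at `w`, coarse at the residue `(ed w).2`):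
the next scale's input `hNDj` of `…TwoVolumeSectorScaleSucc` / `…TwoVolumeSrcSectorScaleSucc` carries no two-volume content. [folklore] -/
theorem sum_filter_norm_keyedGlued_le_add (A' : GrassmannAlgebra 𝕜 Γ') (A : GrassmannAlgebra 𝕜 Γ) {m : ℕ} (p : Fin m) (w : Γ') :
    ∑ X ∈ univ.filter (fun X : Fin m → Γ' => X p = w),
        ‖kernel 𝕜 A' m X - (if ∀ i, (ed (X i)).1 = (ed (X p)).1 then kernel 𝕜 A m (fun i => (ed (X i)).2) else 0)‖ ≤
      ∑ X ∈ univ.filter (fun X : Fin m → Γ' => X p = w), ‖kernel 𝕜 A' m X‖ +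
        ∑ Y ∈ univ.filter (fun Y : Fin m → Γ => Y p = (ed w).2), ‖kernel 𝕜 A m Y‖ := by
  rw [← sum_filter_norm_keyedReduced_eq ed A p w, ← sum_add_distrib]
  exact sum_le_sum fun X _ => norm_sub_le _ _

/-- The same with the two one-volume pinned profiles bounded by `N′` and `N`: the «everywhere» defect is at most `N′ + N`. [folklore] -/
theorem sum_filter_norm_keyedGlued_le_of_profiles (A' : GrassmannAlgebra 𝕜 Γ') (A : GrassmannAlgebra 𝕜 Γ) {m : ℕ} (p : Fin m) (w : Γ')
    {N' N : ℝ} (hN' : ∑ X ∈ univ.filter (fun X : Fin m → Γ' => X p = w), ‖kernel 𝕜 A' m X‖ ≤ N')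
    (hN : ∑ Y ∈ univ.filter (fun Y : Fin m → Γ => Y p = (ed w).2), ‖kernel 𝕜 A m Y‖ ≤ N) :
    ∑ X ∈ univ.filter (fun X : Fin m → Γ' => X p = w),
        ‖kernel 𝕜 A' m X - (if ∀ i, (ed (X i)).1 = (ed (X p)).1 then kernel 𝕜 A m (fun i => (ed (X i)).2) else 0)‖ ≤ N' + N :=
  (sum_filter_norm_keyedGlued_le_add ed A' A p w).trans (add_le_add hN' hN)

/-! ## §2 The keyed block-reduced defect through the source truncation -/

variable (P : Γ → Prop) [DecidablePred P] (P' : Γ' → Prop) [DecidablePred P']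

omit [Fintype Γ] [DecidableEq Γ] [Fintype Γ'] [DecidableEq Γ'] [DecidableEq ι] in
/-- If the source predicates are compatible with the residue map, the residue string has the source count of the string. [folklore] -/
theorem srcCount_keyedResidue_eq (hP : ∀ x, P (ed x).2 ↔ P' x) {m : ℕ} (X : Fin m → Γ') :
    srcCount P (fun i => (ed (X i)).2) = srcCount P' X := by
  unfold srcCount
  congr 1
  exact filter_congr fun j _ => hP (X j)

/-- **Termwise**: the keyed block-reduced defect of the truncations is at most that of the originals (both sides are cut by the same test).
[cite: BenfattoGiulianiMastropietro2006, §2.9 (4.3)-(4.6)] -/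
theorem norm_kernel_srcTrunc_keyedGlued_le (hP : ∀ x, P (ed x).2 ↔ P' x) (k : ℕ) (A' : GrassmannAlgebra 𝕜 Γ') (A : GrassmannAlgebra 𝕜 Γ)
    {m : ℕ} (p : Fin m) (X : Fin m → Γ') :
    ‖kernel 𝕜 (srcTrunc 𝕜 P' k A') m X -
        (if ∀ i, (ed (X i)).1 = (ed (X p)).1 then kernel 𝕜 (srcTrunc 𝕜 P k A) m (fun i => (ed (X i)).2) else 0)‖ ≤
      ‖kernel 𝕜 A' m X - (if ∀ i, (ed (X i)).1 = (ed (X p)).1 then kernel 𝕜 A m (fun i => (ed (X i)).2) else 0)‖ := by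
  rw [kernel_srcTrunc, kernel_srcTrunc, srcCount_keyedResidue_eq ed P P' hP X]
  by_cases h : srcCount P' X < k
  · rw [if_pos h, if_pos h]
  · rw [if_neg h, if_neg h, ite_self, sub_zero, norm_zero]
    exact norm_nonneg _

/-- **Over any finite set of strings, with any non-negative weight**: the keyed block-reduced defect of the truncations is at most that of the
originals. [cite: BenfattoGiulianiMastropietro2006, §2.9 (4.3)-(4.6)] -/
theorem sum_norm_kernel_srcTrunc_keyedGlued_mul_le (hP : ∀ x, P (ed x).2 ↔ P' x) (k : ℕ) (A' : GrassmannAlgebra 𝕜 Γ') (A : GrassmannAlgebra 𝕜 Γ)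
    {m : ℕ} (p : Fin m) (s : Finset (Fin m → Γ')) (wt : (Fin m → Γ') → ℝ) (hwt : ∀ X, 0 ≤ wt X) :
    ∑ X ∈ s, ‖kernel 𝕜 (srcTrunc 𝕜 P' k A') m X -
        (if ∀ i, (ed (X i)).1 = (ed (X p)).1 then kernel 𝕜 (srcTrunc 𝕜 P k A) m (fun i => (ed (X i)).2) else 0)‖ * wt X ≤
      ∑ X ∈ s, ‖kernel 𝕜 A' m X - (if ∀ i, (ed (X i)).1 = (ed (X p)).1 then kernel 𝕜 A m (fun i => (ed (X i)).2) else 0)‖ * wt X :=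
  sum_le_sum fun X _ => mul_le_mul_of_nonneg_right (norm_kernel_srcTrunc_keyedGlued_le ed P P' hP k A' A p X) (hwt X)

/-- **Over any finite set of strings** (unweighted): the keyed block-reduced defect of the truncations is at most that of the originals.
[cite: BenfattoGiulianiMastropietro2006, §2.9 (4.3)-(4.6)] -/
theorem sum_norm_kernel_srcTrunc_keyedGlued_le (hP : ∀ x, P (ed x).2 ↔ P' x) (k : ℕ) (A' : GrassmannAlgebra 𝕜 Γ') (A : GrassmannAlgebra 𝕜 Γ)
    {m : ℕ} (p : Fin m) (s : Finset (Fin m → Γ')) :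
    ∑ X ∈ s, ‖kernel 𝕜 (srcTrunc 𝕜 P' k A') m X -
        (if ∀ i, (ed (X i)).1 = (ed (X p)).1 then kernel 𝕜 (srcTrunc 𝕜 P k A) m (fun i => (ed (X i)).2) else 0)‖ ≤
      ∑ X ∈ s, ‖kernel 𝕜 A' m X - (if ∀ i, (ed (X i)).1 = (ed (X p)).1 then kernel 𝕜 A m (fun i => (ed (X i)).2) else 0)‖ :=
  sum_le_sum fun X _ => norm_kernel_srcTrunc_keyedGlued_le ed P P' hP k A' A p X

end Keyed

/-! ## §3 The decorated-leg (doubled sector-field) instances: the residue keeps the copy index -/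

section Doubled

variable {b L Lf : ℕ} {T S C : Type*}
  (e : (T × TorusSite 2 Lf) × S ≃ (Fin 2 → Fin b) × ((T × TorusSite 2 L) × S))
  (ed : ((T × TorusSite 2 Lf) × S) × C ≃ (Fin 2 → Fin b) × (((T × TorusSite 2 L) × S) × C))

/-- For the doubled block structure `ed` over `e` (`exists_doubledEquiv`), the residue of a decorated leg keeps its decoration (copy index).
[folklore] -/
theorem snd_snd_doubledEquiv (hed : ∀ x s, ed (x, s) = ((e x).1, ((e x).2, s))) (X' : ((T × TorusSite 2 Lf) × S) × C) :
    ((ed X').2).2 = X'.2 := by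
  have h := hed X'.1 X'.2
  rw [Prod.mk.eta] at h
  rw [h]

/-- Hence every copy predicate is compatible with the residue map. [folklore] -/
theorem copyPred_iff_of_doubledEquiv (hed : ∀ x s, ed (x, s) = ((e x).1, ((e x).2, s))) (Q : C → Prop) (X' : ((T × TorusSite 2 Lf) × S) × C) :
    Q ((ed X').2).2 ↔ Q X'.2 := by
  rw [snd_snd_doubledEquiv e ed hed]

variable [Fintype T] [DecidableEq T] [Fintype S] [DecidableEq S] [Fintype C] [DecidableEq C] [NeZero L] [NeZero Lf]

/-- **The keyed block-reduced defect of the copy-`c` truncations on decorated legs is at most that of the originals**, over any finite set of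
strings (the shape of M3d's conclusion with `srcTrunc` inserted on both sides). [cite: BenfattoGiulianiMastropietro2006, §2.9 (4.3)-(4.6)] -/
theorem sum_norm_kernel_srcTrunc_keyedGlued_le_of_doubledEquiv (hed : ∀ x s, ed (x, s) = ((e x).1, ((e x).2, s))) (c : C) (k : ℕ)
    (A' : GrassmannAlgebra ℂ (((T × TorusSite 2 Lf) × S) × C)) (A : GrassmannAlgebra ℂ (((T × TorusSite 2 L) × S) × C))
    {m : ℕ} (p : Fin m) (s : Finset (Fin m → ((T × TorusSite 2 Lf) × S) × C)) :
    ∑ X ∈ s, ‖kernel ℂ (srcTrunc ℂ (fun Y : ((T × TorusSite 2 Lf) × S) × C => Y.2 = c) k A') m X -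
        (if ∀ i, (ed (X i)).1 = (ed (X p)).1 then
          kernel ℂ (srcTrunc ℂ (fun Y : ((T × TorusSite 2 L) × S) × C => Y.2 = c) k A) m (fun i => (ed (X i)).2) else 0)‖ ≤
      ∑ X ∈ s, ‖kernel ℂ A' m X - (if ∀ i, (ed (X i)).1 = (ed (X p)).1 then kernel ℂ A m (fun i => (ed (X i)).2) else 0)‖ :=
  sum_norm_kernel_srcTrunc_keyedGlued_le ed (fun Y : ((T × TorusSite 2 L) × S) × C => Y.2 = c)
    (fun Y : ((T × TorusSite 2 Lf) × S) × C => Y.2 = c) (fun X' => copyPred_iff_of_doubledEquiv e ed hed (· = c) X') k A' A p s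

omit [Fintype T] [DecidableEq T] [Fintype S] [DecidableEq S] [Fintype C] [NeZero L] [NeZero Lf] in
/-- The e-free residue string of decorated legs keeps the copy index, so it has the copy-`c` source count of the string. [folklore] -/
theorem srcCount_residueString_eq (c : C) {m : ℕ} (X : Fin m → ((T × TorusSite 2 Lf) × S) × C) :
    srcCount (fun Y : ((T × TorusSite 2 L) × S) × C => Y.2 = c)
        (fun i => ((((X i).1.1.1, fun j => ((((X i).1.1.2 j).val : ℕ) : ZMod L)), (X i).1.2), (X i).2)) =
      srcCount (fun Y : ((T × TorusSite 2 Lf) × S) × C => Y.2 = c) X := by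
  unfold srcCount
  rfl

/-- **e-FREE twin** (M4a's / the `_forall` door's currency: block test by site quotients, explicit residue string): the block-reduced defect of the
copy-`c` truncations is at most that of the originals, over any finite set of strings. [cite: BenfattoGiulianiMastropietro2006, §2.9 (4.3)-(4.6)] -/
theorem sum_norm_kernel_srcTrunc_gluedFree_le (c : C) (k : ℕ)
    (A' : GrassmannAlgebra ℂ (((T × TorusSite 2 Lf) × S) × C)) (A : GrassmannAlgebra ℂ (((T × TorusSite 2 L) × S) × C))
    {m : ℕ} (p : Fin m) (s : Finset (Fin m → ((T × TorusSite 2 Lf) × S) × C)) :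
    ∑ X ∈ s, ‖kernel ℂ (srcTrunc ℂ (fun Y : ((T × TorusSite 2 Lf) × S) × C => Y.2 = c) k A') m X -
        (if ∀ i j, ((X i).1.1.2 j).val / L = ((X p).1.1.2 j).val / L then
          kernel ℂ (srcTrunc ℂ (fun Y : ((T × TorusSite 2 L) × S) × C => Y.2 = c) k A) m
            (fun i => ((((X i).1.1.1, fun j => ((((X i).1.1.2 j).val : ℕ) : ZMod L)), (X i).1.2), (X i).2)) else 0)‖ ≤
      ∑ X ∈ s, ‖kernel ℂ A' m X -
        (if ∀ i j, ((X i).1.1.2 j).val / L = ((X p).1.1.2 j).val / L then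
          kernel ℂ A m (fun i => ((((X i).1.1.1, fun j => ((((X i).1.1.2 j).val : ℕ) : ZMod L)), (X i).1.2), (X i).2)) else 0)‖ := by
  refine sum_le_sum fun X _ => ?_
  rw [kernel_srcTrunc, kernel_srcTrunc, srcCount_residueString_eq c X]
  by_cases h : srcCount (fun Y : ((T × TorusSite 2 Lf) × S) × C => Y.2 = c) X < k
  · rw [if_pos h, if_pos h]
  · rw [if_neg h, if_neg h, ite_self, sub_zero, norm_zero]
    exact norm_nonneg _

end Doubled

/-! ## §4 The `SrcLabel` instance the spine reads (M3d's label types, copy `1` = source legs, any truncation order `k`) -/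

section SrcLabelInstance

open Summit.HubbardSuperconductivity.HubbardSuperconductivity.Theorems.TwoVolumeSource

variable {b L Lf M N : ℕ} [NeZero L] [NeZero Lf]
  (e : (SpaceTimeIdx Lf M × SectorLeg N) ≃ (Fin 2 → Fin b) × (SpaceTimeIdx L M × SectorLeg N))
  (ed : ((SpaceTimeIdx Lf M × SectorLeg N) × Fin 2) ≃ (Fin 2 → Fin b) × ((SpaceTimeIdx L M × SectorLeg N) × Fin 2))

/-- **BETWEEN TWO SCALES OF THE SPINE** — on M3d's doubled sector-field legs `(SpaceTimeIdx V M × SectorLeg N) × Fin 2` with the doubled block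
structure `ed` over `e` (`hed`), the keyed block-reduced defect of the source truncations `srcTrunc (·.2 = 1) k O′` vs `srcTrunc (·.2 = 1) k O`
pinned at `w` is at most M3d's left-hand side for `O′` vs `O`. [cite: BenfattoGiulianiMastropietro2006, §2.9 (4.3)-(4.6)] -/
theorem srcLabel_sum_filter_norm_srcTrunc_keyedGlued_le (hed : ∀ x s, ed (x, s) = ((e x).1, ((e x).2, s))) (k : ℕ)
    (O' : GrassmannAlgebra ℂ ((SpaceTimeIdx Lf M × SectorLeg N) × Fin 2)) (O : GrassmannAlgebra ℂ ((SpaceTimeIdx L M × SectorLeg N) × Fin 2))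
    (n : ℕ) (p : Fin (n + 1)) (w : (SpaceTimeIdx Lf M × SectorLeg N) × Fin 2) :
    ∑ X ∈ univ.filter (fun X : Fin (n + 1) → (SpaceTimeIdx Lf M × SectorLeg N) × Fin 2 => X p = w),
        ‖kernel ℂ (srcTrunc ℂ (fun Y : (SpaceTimeIdx Lf M × SectorLeg N) × Fin 2 => Y.2 = 1) k O') (n + 1) X -
          (if ∀ i, (ed (X i)).1 = (ed (X p)).1 then
            kernel ℂ (srcTrunc ℂ (fun Y : (SpaceTimeIdx L M × SectorLeg N) × Fin 2 => Y.2 = 1) k O) (n + 1) (fun i => (ed (X i)).2) else 0)‖ ≤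
      ∑ X ∈ univ.filter (fun X : Fin (n + 1) → (SpaceTimeIdx Lf M × SectorLeg N) × Fin 2 => X p = w),
        ‖kernel ℂ O' (n + 1) X - (if ∀ i, (ed (X i)).1 = (ed (X p)).1 then kernel ℂ O (n + 1) (fun i => (ed (X i)).2) else 0)‖ :=
  sum_norm_kernel_srcTrunc_keyedGlued_le_of_doubledEquiv e ed hed 1 k O' O p _

/-- The same with M3d's bound `B` carried through: if M3d gives `≤ B` for the untruncated outputs, the truncated ones satisfy `≤ B`.
[cite: BenfattoGiulianiMastropietro2006, §2.9 (4.3)-(4.6)] -/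
theorem srcLabel_sum_filter_norm_srcTrunc_keyedGlued_le_of_le (hed : ∀ x s, ed (x, s) = ((e x).1, ((e x).2, s))) (k : ℕ)
    (O' : GrassmannAlgebra ℂ ((SpaceTimeIdx Lf M × SectorLeg N) × Fin 2)) (O : GrassmannAlgebra ℂ ((SpaceTimeIdx L M × SectorLeg N) × Fin 2))
    (n : ℕ) (p : Fin (n + 1)) (w : (SpaceTimeIdx Lf M × SectorLeg N) × Fin 2) {B : ℝ}
    (hB : ∑ X ∈ univ.filter (fun X : Fin (n + 1) → (SpaceTimeIdx Lf M × SectorLeg N) × Fin 2 => X p = w),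
        ‖kernel ℂ O' (n + 1) X - (if ∀ i, (ed (X i)).1 = (ed (X p)).1 then kernel ℂ O (n + 1) (fun i => (ed (X i)).2) else 0)‖ ≤ B) :
    ∑ X ∈ univ.filter (fun X : Fin (n + 1) → (SpaceTimeIdx Lf M × SectorLeg N) × Fin 2 => X p = w),
        ‖kernel ℂ (srcTrunc ℂ (fun Y : (SpaceTimeIdx Lf M × SectorLeg N) × Fin 2 => Y.2 = 1) k O') (n + 1) X -
          (if ∀ i, (ed (X i)).1 = (ed (X p)).1 then
            kernel ℂ (srcTrunc ℂ (fun Y : (SpaceTimeIdx L M × SectorLeg N) × Fin 2 => Y.2 = 1) k O) (n + 1) (fun i => (ed (X i)).2) else 0)‖ ≤ B :=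
  (srcLabel_sum_filter_norm_srcTrunc_keyedGlued_le e ed hed k O' O n p w).trans hB

/-- **The next scale's «everywhere» input on the doubled sector-field legs**: the keyed two-volume defect of ANY two elements pinned at `w` is at
most the fine pinned profile at `w` plus the coarse pinned profile at the residue `(ed w).2`. [folklore] -/
theorem srcLabel_sum_filter_norm_keyedGlued_le_of_profiles
    (A' : GrassmannAlgebra ℂ ((SpaceTimeIdx Lf M × SectorLeg N) × Fin 2)) (A : GrassmannAlgebra ℂ ((SpaceTimeIdx L M × SectorLeg N) × Fin 2))
    (k : ℕ) (p : Fin k) (w : (SpaceTimeIdx Lf M × SectorLeg N) × Fin 2) {N' Nc : ℝ}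
    (hN' : ∑ X ∈ univ.filter (fun X : Fin k → (SpaceTimeIdx Lf M × SectorLeg N) × Fin 2 => X p = w), ‖kernel ℂ A' k X‖ ≤ N')
    (hNc : ∑ Y ∈ univ.filter (fun Y : Fin k → (SpaceTimeIdx L M × SectorLeg N) × Fin 2 => Y p = (ed w).2), ‖kernel ℂ A k Y‖ ≤ Nc) :
    ∑ X ∈ univ.filter (fun X : Fin k → (SpaceTimeIdx Lf M × SectorLeg N) × Fin 2 => X p = w),
        ‖kernel ℂ A' k X - (if ∀ i, (ed (X i)).1 = (ed (X p)).1 then kernel ℂ A k (fun i => (ed (X i)).2) else 0)‖ ≤ N' + Nc :=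
  sum_filter_norm_keyedGlued_le_of_profiles ed A' A p w hN' hNc

end SrcLabelInstance

/-! ## §5 (addendum) Splicing ONE-volume kernel differences into the keyed defect — the fine side's brackets (i)/(ii) (own frame `K″` vs the
common frame `K`: covariance response `…TwoVolumeFrameResponse`, substitution difference `…TwoVolumeSubstitutionLipschitz`) enter the spine as a
pinned one-volume difference `Σ ‖kernel A′ X − kernel B′ X‖` on the fine labels; a coarse-side twin (reindexed by `ed`); and one-volume differences
through the truncation -/

section Splice

variable {𝕜 : Type*} [RCLike 𝕜] {Γ Γ' ι : Type*} [Fintype Γ] [DecidableEq Γ] [Fintype Γ'] [DecidableEq Γ'] [DecidableEq ι]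
  (ed : Γ' ≃ ι × Γ)

omit [Fintype Γ] [DecidableEq Γ] [Fintype Γ'] [DecidableEq Γ'] in
/-- **Fine-side splice**: the keyed defect of `(A′, A)` is at most the one-volume difference `A′ − B′` plus the keyed defect of `(B′, A)`, over any
finite set of strings (use: `A′` = the fine volume's TRUE next-scale object at its own frame, `B′` = the common-frame object M3a/M3d compare). [folklore] -/
theorem sum_norm_keyedGlued_le_add_of_fine (A' B' : GrassmannAlgebra 𝕜 Γ') (A : GrassmannAlgebra 𝕜 Γ) {m : ℕ} (p : Fin m) (s : Finset (Fin m → Γ')) :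
    ∑ X ∈ s, ‖kernel 𝕜 A' m X - (if ∀ i, (ed (X i)).1 = (ed (X p)).1 then kernel 𝕜 A m (fun i => (ed (X i)).2) else 0)‖ ≤
      ∑ X ∈ s, ‖kernel 𝕜 A' m X - kernel 𝕜 B' m X‖ +
        ∑ X ∈ s, ‖kernel 𝕜 B' m X - (if ∀ i, (ed (X i)).1 = (ed (X p)).1 then kernel 𝕜 A m (fun i => (ed (X i)).2) else 0)‖ := by
  rw [← sum_add_distrib]
  exact sum_le_sum fun X _ => norm_sub_le_norm_sub_add_norm_sub _ _ _

omit [Fintype Γ] [DecidableEq Γ] [Fintype Γ'] [DecidableEq Γ'] in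
/-- Fine-side splice with the two bounds carried: response `≤ r` and keyed defect `≤ D` give keyed defect `≤ r + D`. [folklore] -/
theorem sum_norm_keyedGlued_le_of_fine_response (A' B' : GrassmannAlgebra 𝕜 Γ') (A : GrassmannAlgebra 𝕜 Γ) {m : ℕ} (p : Fin m)
    (s : Finset (Fin m → Γ')) {r D : ℝ} (hr : ∑ X ∈ s, ‖kernel 𝕜 A' m X - kernel 𝕜 B' m X‖ ≤ r)
    (hD : ∑ X ∈ s, ‖kernel 𝕜 B' m X - (if ∀ i, (ed (X i)).1 = (ed (X p)).1 then kernel 𝕜 A m (fun i => (ed (X i)).2) else 0)‖ ≤ D) :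
    ∑ X ∈ s, ‖kernel 𝕜 A' m X - (if ∀ i, (ed (X i)).1 = (ed (X p)).1 then kernel 𝕜 A m (fun i => (ed (X i)).2) else 0)‖ ≤ r + D :=
  (sum_norm_keyedGlued_le_add_of_fine ed A' B' A p s).trans (add_le_add hr hD)

/-- **The keyed reduced kernels of two coarse elements differ, pinned at `w`, by exactly the coarse pinned difference at the residue `(ed w).2`.**
[folklore] -/
theorem sum_filter_norm_keyedReduced_sub_keyedReduced_eq (A B : GrassmannAlgebra 𝕜 Γ) {m : ℕ} (p : Fin m) (w : Γ') :
    ∑ X ∈ univ.filter (fun X : Fin m → Γ' => X p = w),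
        ‖(if ∀ i, (ed (X i)).1 = (ed (X p)).1 then kernel 𝕜 A m (fun i => (ed (X i)).2) else 0) -
          (if ∀ i, (ed (X i)).1 = (ed (X p)).1 then kernel 𝕜 B m (fun i => (ed (X i)).2) else 0)‖ =
      ∑ Y ∈ univ.filter (fun Y : Fin m → Γ => Y p = (ed w).2), ‖kernel 𝕜 A m Y - kernel 𝕜 B m Y‖ := by
  rw [← sum_filter_ite_blockTest_eq ed (fun Y => ‖kernel 𝕜 A m Y - kernel 𝕜 B m Y‖) p w]
  refine sum_congr rfl fun X _ => ?_
  split_ifs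
  · rfl
  · rw [sub_zero, norm_zero]

/-- **Coarse-side splice**: the keyed defect of `(A′, B)` pinned at `w` is at most the keyed defect of `(A′, A)` plus the coarse one-volume pinned
difference `A − B` at the residue `(ed w).2`. [folklore] -/
theorem sum_filter_norm_keyedGlued_le_add_of_coarse (A' : GrassmannAlgebra 𝕜 Γ') (A B : GrassmannAlgebra 𝕜 Γ) {m : ℕ} (p : Fin m) (w : Γ') :
    ∑ X ∈ univ.filter (fun X : Fin m → Γ' => X p = w),
        ‖kernel 𝕜 A' m X - (if ∀ i, (ed (X i)).1 = (ed (X p)).1 then kernel 𝕜 B m (fun i => (ed (X i)).2) else 0)‖ ≤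
      ∑ X ∈ univ.filter (fun X : Fin m → Γ' => X p = w),
          ‖kernel 𝕜 A' m X - (if ∀ i, (ed (X i)).1 = (ed (X p)).1 then kernel 𝕜 A m (fun i => (ed (X i)).2) else 0)‖ +
        ∑ Y ∈ univ.filter (fun Y : Fin m → Γ => Y p = (ed w).2), ‖kernel 𝕜 A m Y - kernel 𝕜 B m Y‖ := by
  rw [← sum_filter_norm_keyedReduced_sub_keyedReduced_eq ed A B p w, ← sum_add_distrib]
  exact sum_le_sum fun X _ => norm_sub_le_norm_sub_add_norm_sub _ _ _

/-- Coarse-side splice with the two bounds carried. [folklore] -/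
theorem sum_filter_norm_keyedGlued_le_of_coarse_response (A' : GrassmannAlgebra 𝕜 Γ') (A B : GrassmannAlgebra 𝕜 Γ) {m : ℕ} (p : Fin m) (w : Γ')
    {D r : ℝ}
    (hD : ∑ X ∈ univ.filter (fun X : Fin m → Γ' => X p = w),
      ‖kernel 𝕜 A' m X - (if ∀ i, (ed (X i)).1 = (ed (X p)).1 then kernel 𝕜 A m (fun i => (ed (X i)).2) else 0)‖ ≤ D)
    (hr : ∑ Y ∈ univ.filter (fun Y : Fin m → Γ => Y p = (ed w).2), ‖kernel 𝕜 A m Y - kernel 𝕜 B m Y‖ ≤ r) :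
    ∑ X ∈ univ.filter (fun X : Fin m → Γ' => X p = w),
        ‖kernel 𝕜 A' m X - (if ∀ i, (ed (X i)).1 = (ed (X p)).1 then kernel 𝕜 B m (fun i => (ed (X i)).2) else 0)‖ ≤ D + r :=
  (sum_filter_norm_keyedGlued_le_add_of_coarse ed A' A B p w).trans (add_le_add hD hr)

variable (P' : Γ' → Prop) [DecidablePred P']

omit [Fintype Γ] [DecidableEq Γ] [DecidableEq ι] in
/-- **Termwise**: a one-volume kernel difference through the truncation is at most the untruncated difference (same test on both terms).
[cite: BenfattoGiulianiMastropietro2006, §2.9 (4.3)-(4.6)] -/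
theorem norm_kernel_srcTrunc_sub_srcTrunc_le (k : ℕ) (A' B' : GrassmannAlgebra 𝕜 Γ') {m : ℕ} (X : Fin m → Γ') :
    ‖kernel 𝕜 (srcTrunc 𝕜 P' k A') m X - kernel 𝕜 (srcTrunc 𝕜 P' k B') m X‖ ≤ ‖kernel 𝕜 A' m X - kernel 𝕜 B' m X‖ := by
  rw [kernel_srcTrunc, kernel_srcTrunc]
  by_cases h : srcCount P' X < k
  · rw [if_pos h, if_pos h]
  · rw [if_neg h, if_neg h, sub_zero, norm_zero]
    exact norm_nonneg _

omit [Fintype Γ] [DecidableEq Γ] [DecidableEq ι] in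
/-- **Over any finite set of strings, any weight ≥ 0**: one-volume kernel differences through the truncation are at most the untruncated ones.
[cite: BenfattoGiulianiMastropietro2006, §2.9 (4.3)-(4.6)] -/
theorem sum_norm_kernel_srcTrunc_sub_srcTrunc_mul_le (k : ℕ) (A' B' : GrassmannAlgebra 𝕜 Γ') {m : ℕ} (s : Finset (Fin m → Γ'))
    (wt : (Fin m → Γ') → ℝ) (hwt : ∀ X, 0 ≤ wt X) :
    ∑ X ∈ s, ‖kernel 𝕜 (srcTrunc 𝕜 P' k A') m X - kernel 𝕜 (srcTrunc 𝕜 P' k B') m X‖ * wt X ≤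
      ∑ X ∈ s, ‖kernel 𝕜 A' m X - kernel 𝕜 B' m X‖ * wt X :=
  sum_le_sum fun X _ => mul_le_mul_of_nonneg_right (norm_kernel_srcTrunc_sub_srcTrunc_le P' k A' B' X) (hwt X)

omit [Fintype Γ] [DecidableEq Γ] [DecidableEq ι] in
/-- Unweighted form over any finite set of strings. [cite: BenfattoGiulianiMastropietro2006, §2.9 (4.3)-(4.6)] -/
theorem sum_norm_kernel_srcTrunc_sub_srcTrunc_le (k : ℕ) (A' B' : GrassmannAlgebra 𝕜 Γ') {m : ℕ} (s : Finset (Fin m → Γ')) :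
    ∑ X ∈ s, ‖kernel 𝕜 (srcTrunc 𝕜 P' k A') m X - kernel 𝕜 (srcTrunc 𝕜 P' k B') m X‖ ≤ ∑ X ∈ s, ‖kernel 𝕜 A' m X - kernel 𝕜 B' m X‖ :=
  sum_le_sum fun X _ => norm_kernel_srcTrunc_sub_srcTrunc_le P' k A' B' X

end Splice

/-! ## §6 (addendum) One scale of the fine side, end to end, on M3d's label types: TRUE (own frame) → common frame (response `r`) → M3d (`B`)
→ truncation; the next scale's deep input is `≤ r + B` -/

section SrcLabelSplice

variable {b L Lf M N : ℕ} [NeZero L] [NeZero Lf]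
  (e : (SpaceTimeIdx Lf M × SectorLeg N) ≃ (Fin 2 → Fin b) × (SpaceTimeIdx L M × SectorLeg N))
  (ed : ((SpaceTimeIdx Lf M × SectorLeg N) × Fin 2) ≃ (Fin 2 → Fin b) × ((SpaceTimeIdx L M × SectorLeg N) × Fin 2))

/-- **THE NEXT SCALE'S DEEP INPUT FROM ONE FINE-SIDE RESPONSE AND ONE M3d CALL**: if the fine volume's TRUE untruncated output `O′` differs from the
common-frame one `Oc′` by `≤ r` (pinned one-volume kernel difference at `w`, degree `n+1`) and M3d bounds the keyed defect of `(Oc′, O)` at `w` by `B`,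
then the keyed defect of the TRUNCATED pair `(srcTrunc (·.2=1) k O′, srcTrunc (·.2=1) k O)` at `w` is `≤ r + B`.
[cite: BenfattoGiulianiMastropietro2006, §2.9 (4.3)-(4.6)] -/
theorem srcLabel_sum_filter_norm_srcTrunc_keyedGlued_le_of_response_of_le (hed : ∀ x s, ed (x, s) = ((e x).1, ((e x).2, s))) (k : ℕ)
    (O' Oc' : GrassmannAlgebra ℂ ((SpaceTimeIdx Lf M × SectorLeg N) × Fin 2)) (O : GrassmannAlgebra ℂ ((SpaceTimeIdx L M × SectorLeg N) × Fin 2))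
    (n : ℕ) (p : Fin (n + 1)) (w : (SpaceTimeIdx Lf M × SectorLeg N) × Fin 2) {r B : ℝ}
    (hr : ∑ X ∈ univ.filter (fun X : Fin (n + 1) → (SpaceTimeIdx Lf M × SectorLeg N) × Fin 2 => X p = w),
        ‖kernel ℂ O' (n + 1) X - kernel ℂ Oc' (n + 1) X‖ ≤ r)
    (hB : ∑ X ∈ univ.filter (fun X : Fin (n + 1) → (SpaceTimeIdx Lf M × SectorLeg N) × Fin 2 => X p = w),
        ‖kernel ℂ Oc' (n + 1) X - (if ∀ i, (ed (X i)).1 = (ed (X p)).1 then kernel ℂ O (n + 1) (fun i => (ed (X i)).2) else 0)‖ ≤ B) :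
    ∑ X ∈ univ.filter (fun X : Fin (n + 1) → (SpaceTimeIdx Lf M × SectorLeg N) × Fin 2 => X p = w),
        ‖kernel ℂ (srcTrunc ℂ (fun Y : (SpaceTimeIdx Lf M × SectorLeg N) × Fin 2 => Y.2 = 1) k O') (n + 1) X -
          (if ∀ i, (ed (X i)).1 = (ed (X p)).1 then
            kernel ℂ (srcTrunc ℂ (fun Y : (SpaceTimeIdx L M × SectorLeg N) × Fin 2 => Y.2 = 1) k O) (n + 1) (fun i => (ed (X i)).2) else 0)‖ ≤
      r + B :=
  srcLabel_sum_filter_norm_srcTrunc_keyedGlued_le_of_le e ed hed k O' O n p w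
    (sum_norm_keyedGlued_le_of_fine_response ed O' Oc' O p _ hr hB)

end SrcLabelSplice

end Summit.HubbardSuperconductivity.HubbardSuperconductivity.Theorems.TwoVolumeDefect

end
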